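import Summits.Ventures.PercRepro.Night2T4Facts
import Summits.Ventures.PercRepro.GenQSevenFiveColoopFree

/-!
# PercRepro — the profile facts of the `(8, 6)` cell at every type (night-4, gen 4)

The profile LP of night-2 (`NIGHT-2-profile.md` §3, `mining/night-2/g4/leanlp_t.py`) certifies a layer of the
per-flat balance corank by corank from the Lean facts (P1)–(P3), (L1)–(L5), absorption and the facts of the core.
This file adds what the `(8, 6)` cell (`HighLayersCoreFree 6`: the types `3, 4, 5` on the rank-`6` flats; and
`TraceSumsCore 5`: the rank-`5` trace sums at level `6`) needs beyond night-2's type-`3` / type-`4` / level-`5` files: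

* `Jq_mul_succ_eq_profile`: the balance at EVERY type `t` in the profile,
  `(q+1)·J_t = (q+2)·DF_t + Σ_k Σ_m #Pc k m · ((q+1)(q+2−t)/(1+m) − (q+2))`;
* `sum_card_Pc_le_DFq_of_lt`: the levels `0 … t − 1` are demand-free at type `t`
  (a complement of `≤ t − 1` points has rank `≤ t − 1`);
* `card_Pc_eq_zero_of_flats_le`: when every rank-`r` flat of `M` has `≤ s` points, a set of cyclic rank `r`
  (`m(S) = q − r`) has a cyclic part of `≤ s` points — `#Pc k (q − r) = 0` when `d − k + r ≥ s + 1`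
  (the planes `≤ 6` / solids `≤ 10` / rank-`5` flats `≤ 21` rows of the core);
* `card_le_mTr_add_of_flats`: a rank-`q` set with `m` coloops has `≤ m + s` points when its rank-`(q − m)` flats
  have `≤ s` points;
* `traceSum_mul_succ_eq_profile`: the trace sum of level `q + 1` at type `t`, times `q + 2`, in the profile,
  `(q+2)·TS_t = (q+3)·DF_t + Σ_k Σ_m #Pc k m · ((q+2)(q+3−t)/(2+m) − (q+3))`;
* `traceSum_nonneg_of_card_le'`: at corank `≤ t − 1` the trace sum is `≥ 0` outright (`t ≤ q + 3`).

Imports `Night2T4Facts` (the profile, line and core facts; `Jq_mul_succ_eq_mTr`, `sum_Rq_eq_sum_Pc`,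
`card_level_eq_sum_card_Pc`) and `GenQSevenFiveColoopFree` (`dem`, `TraceSumsCore`'s vocabulary); `sum_dem_eq'` restates
night-2's `sum_dem_eq` (Night2TraceFacts, not yet landed) in five lines so that this file lands on `Night2T4Facts` alone.
-/
namespace PercRepro.Night4

open Finset ThmH SixFour GenQ PerFlat Star

variable {α : Type*} [DecidableEq α] {M : Matroid α} [M.Finite]

/-! ## The balance at every type in the profile -/

/-- **The balance at type `t` in the profile**:
`(q+1)·J_t = (q+2)·DF_t + Σ_{k ≤ d} Σ_m #Pc k m · ((q+1)(q+2−t)/(1+m) − (q+2))`. -/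
theorem Jq_mul_succ_eq_profile {G : Finset α} {q d : ℕ} (hG : G ⊆ gr M)
    (hrG : M.eRk (G : Set α) = (q : ℕ∞)) (hcard : G.card = q + d) (t : ℕ) :
    ((q : ℚ) + 1) * Jq M G q t = ((q : ℚ) + 2) * (DFq M G q t : ℚ) +
      ∑ k ∈ Finset.range (d + 1), ∑ m ∈ Finset.Icc (mTr M G) q,
        ((Pc M G q k m).card : ℚ) * (((q : ℚ) + 1) * ((q : ℚ) + 2 - t) / (1 + (m : ℚ)) - ((q : ℚ) + 2)) := by
  rw [Jq_mul_succ_eq_mTr]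
  congr 1
  have h := sum_Rq_eq_sum_Pc hG hrG hcard
    (fun _ m => ((q : ℚ) + 1) * ((q : ℚ) + 2 - t) / (1 + (m : ℚ)) - ((q : ℚ) + 2))
  rw [← h]

/-! ## The demand-free levels at type `t` -/

/-- The sets whose complement has `≤ t − 1` points are demand-free at type `t`. -/
theorem card_filter_sdiff_lt_le_DFq (G : Finset α) (q t : ℕ) :
    ((Rq M G q).filter (fun S : Finset α => (G \ S).card < t)).card ≤ DFq M G q t := by
  unfold DFq
  apply Finset.card_le_card
  intro S hS
  rw [Finset.mem_filter] at hS ⊢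
  refine ⟨hS.1, ?_⟩
  have h1 : M.eRk ((G \ S : Finset α) : Set α) ≤ ((G \ S).card : ℕ∞) := by
    have := M.eRk_le_encard ((G \ S : Finset α) : Set α)
    rwa [Set.encard_coe_eq_coe_finsetCard] at this
  have h2 : ((G \ S).card : ℕ∞) + 1 ≤ (t : ℕ∞) := by
    have : (G \ S).card + 1 ≤ t := hS.2
    exact_mod_cast this
  calc M.eRk ((G \ S : Finset α) : Set α) + 1 ≤ ((G \ S).card : ℕ∞) + 1 := by gcongr
    _ ≤ (t : ℕ∞) := h2

/-- The levels `0 … t − 1` together are the sets with a complement of `≤ t − 1` points. -/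
theorem sum_card_level_lt_eq (G : Finset α) (q t : ℕ) :
    ∑ k ∈ Finset.range t, ((Rq M G q).filter (fun S : Finset α => (G \ S).card = k)).card =
      ((Rq M G q).filter (fun S : Finset α => (G \ S).card < t)).card := by
  rw [Finset.card_eq_sum_card_fiberwise (s := (Rq M G q).filter (fun S : Finset α => (G \ S).card < t))
    (t := Finset.range t) (f := fun S => (G \ S).card) (fun S hS => by
      have hS' := Finset.mem_filter.1 hS
      exact Finset.mem_coe.2 (Finset.mem_range.2 hS'.2))]
  apply Finset.sum_congr rfl
  intro k hk
  rw [Finset.filter_filter]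
  apply congrArg Finset.card
  apply Finset.filter_congr
  intro S _
  have hk' : k < t := Finset.mem_range.1 hk
  exact ⟨fun h => ⟨by omega, h⟩, fun h => h.2⟩

/-- **The levels `0 … t − 1` are demand-free at type `t`**: `Σ_{k < t} Σ_m #Pc k m ≤ DF_t`. -/
theorem sum_card_Pc_le_DFq_of_lt {G : Finset α} {q : ℕ} (hG : G ⊆ gr M) (hrG : M.eRk (G : Set α) = (q : ℕ∞))
    (t : ℕ) :
    ∑ k ∈ Finset.range t, ∑ m ∈ Finset.Icc (mTr M G) q, (Pc M G q k m).card ≤ DFq M G q t := by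
  have h : ∀ k, ∑ m ∈ Finset.Icc (mTr M G) q, (Pc M G q k m).card =
      ((Rq M G q).filter (fun S : Finset α => (G \ S).card = k)).card :=
    fun k => (card_level_eq_sum_card_Pc hG hrG k).symm
  simp only [h]
  rw [sum_card_level_lt_eq]
  exact card_filter_sdiff_lt_le_DFq (M := M) G q t

/-! ## The flats of bounded size kill a cyclic-rank class -/

/-- The cyclic part of `S ∈ R_q(G)` with `m(S) = q − r` (`r ≤ q`) has rank `r` and lies in its closure, a
rank-`r` flat; so it has `≤ s` points when every rank-`r` flat has `≤ s` points. -/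
theorem card_sdiff_coloopsOf_le_of_flats {r s : ℕ} (hflat : ∀ F ∈ flatsQ M r, F.card ≤ s) {G S : Finset α}
    {q : ℕ} (hG : G ⊆ gr M) (hS : S ∈ Rq M G q) (hr : r ≤ q) (hm : mTr M S = q - r) :
    (S \ coloopsOf M S).card ≤ s := by
  have hSG : S ⊆ G := (mem_Rq.1 hS).1
  have hSg : S ⊆ gr M := hSG.trans hG
  have hZr : M.eRk ((S \ coloopsOf M S : Finset α) : Set α) = (r : ℕ∞) := by
    have h := eRk_sdiff_coloopsOf_add_mTr hG hS
    rw [hm] at h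
    obtain ⟨r', hr'⟩ := exists_eRk_eq_nat (M := M) (S \ coloopsOf M S)
    rw [hr'] at h ⊢
    have h' : r' + (q - r) = q := by exact_mod_cast h
    have : r' = r := by omega
    rw [this]
  have hZE : ((S \ coloopsOf M S : Finset α) : Set α) ⊆ M.E := by
    rw [← coe_gr M]
    exact Finset.coe_subset.2 (Finset.sdiff_subset.trans hSg)
  have hP : clF M (S \ coloopsOf M S) ∈ flatsQ M r := by
    rw [mem_flatsQ]
    refine ⟨?_, ?_, ?_⟩
    · intro x hx
      have hx' : x ∈ M.closure ((S \ coloopsOf M S : Finset α) : Set α) := by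
        rw [← coe_clF]
        exact Finset.mem_coe.2 hx
      have := M.closure_subset_ground _ hx'
      rw [← coe_gr M] at this
      exact Finset.mem_coe.1 this
    · rw [coe_clF]
      exact M.isFlat_closure _
    · rw [coe_clF, M.eRk_closure_eq, hZr]
  have hsub : S \ coloopsOf M S ⊆ clF M (S \ coloopsOf M S) := by
    intro x hx
    rw [← Finset.mem_coe, coe_clF]
    exact M.subset_closure _ hZE (Finset.mem_coe.2 hx)
  exact (Finset.card_le_card hsub).trans (hflat _ hP)

/-- **A flat bound kills a class**: when every rank-`r` flat of `M` has `≤ s` points (`r ≤ q`), the class of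
cyclic rank `r` (`m(S) = q − r`) is empty at every nullity `d − k` with `d − k + r ≥ s + 1`. -/
theorem card_Pc_eq_zero_of_flats_le {r s : ℕ} (hflat : ∀ F ∈ flatsQ M r, F.card ≤ s) {G : Finset α} {q d : ℕ}
    (hG : G ⊆ gr M) (hr : r ≤ q) (hcard : G.card = q + d) {k : ℕ} (hk : s + 1 + k ≤ d + r) :
    (Pc M G q k (q - r)).card = 0 := by
  rw [Finset.card_eq_zero, Finset.eq_empty_iff_forall_notMem]
  intro S hS
  have hS' := mem_Pc.1 hS
  have hSG : S ⊆ G := (mem_Rq.1 hS'.1).1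
  have hqS : q ≤ S.card := le_card_of_eRk_eq (mem_Rq.1 hS'.1).2
  have hZcard : (S \ coloopsOf M S).card = d - k + r := by
    rw [card_sdiff_coloopsOf, hS'.2.2]
    have h1 : (G \ S).card + S.card = G.card := by
      rw [Finset.card_sdiff_of_subset hSG]
      exact Nat.sub_add_cancel (Finset.card_le_card hSG)
    rw [hS'.2.1, hcard] at h1
    omega
  have h := card_sdiff_coloopsOf_le_of_flats hflat hG hS'.1 hr hS'.2.2
  omega

/-- A rank-`q` set with `m` coloops has at most `m + s` points when every rank-`(q − m)` flat has `≤ s` points. -/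
theorem card_le_mTr_add_of_flats {q m s : ℕ} (hflat : ∀ F ∈ flatsQ M (q - m), F.card ≤ s) {H : Finset α}
    (hH : H ⊆ gr M) (hrH : M.eRk (H : Set α) = (q : ℕ∞)) (hm : mTr M H = m) : H.card ≤ m + s := by
  have hHR : H ∈ Rq M H q := mem_Rq.2 ⟨Finset.Subset.refl _, hrH⟩
  have hmq : m ≤ q := by
    rw [← hm]
    exact mTr_le_of_eRk_eq hH hrH
  have h := card_sdiff_coloopsOf_le_of_flats hflat hH hHR (Nat.sub_le q m) (by rw [hm]; omega)
  have hc := card_sdiff_coloopsOf (M := M) H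
  have hmle : mTr M H ≤ H.card := by
    unfold mTr
    exact Finset.card_le_card (coloopsOf_subset H)
  omega

/-! ## The trace sum of level `q + 1` in the profile -/

/-- `Σ_B dem_t(B) = N_q − DF_t` (night-2's `sum_dem_eq`). -/
theorem sum_dem_eq' (G : Finset α) (q t : ℕ) :
    ∑ B ∈ Rq M G q, GenQ.dem M G t B = (Nq M G q : ℚ) - (DFq M G q t : ℚ) := by
  rw [Nq_sub_DFq]
  unfold GenQ.dem
  rw [Finset.sum_ite, Finset.sum_const_zero, zero_add, Finset.sum_const, nsmul_eq_mul, mul_one]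

/-- **The trace sum at type `t`, times `q + 2`, in the profile**:
`(q+2)·TS_t = (q+3)·DF_t + Σ_{k ≤ d} Σ_m #Pc k m · ((q+2)(q+3−t)/(2+m) − (q+3))`. -/
theorem traceSum_mul_succ_eq_profile {H : Finset α} {q d : ℕ} (hH : H ⊆ gr M)
    (hrH : M.eRk (H : Set α) = (q : ℕ∞)) (hcard : H.card = q + d) (t : ℕ) :
    ((q : ℚ) + 2) * ∑ B ∈ Rq M H q, ((((q + 1 : ℕ) : ℚ) + 2 - t) * (1 / (2 + (mTr M B : ℚ))) -
        ((((q + 1 : ℕ) : ℚ) + 2) / (((q + 1 : ℕ) : ℚ) + 1)) * GenQ.dem M H t B) =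
      ((q : ℚ) + 3) * (DFq M H q t : ℚ) + ∑ k ∈ Finset.range (d + 1), ∑ m ∈ Finset.Icc (mTr M H) q,
        ((Pc M H q k m).card : ℚ) * (((q : ℚ) + 2) * ((q : ℚ) + 3 - t) / (2 + (m : ℚ)) - ((q : ℚ) + 3)) := by
  have h1 := sum_Rq_eq_sum_Pc hH hrH hcard
    (fun _ m => ((q : ℚ) + 2) * ((q : ℚ) + 3 - t) / (2 + (m : ℚ)) - ((q : ℚ) + 3))
  rw [← h1]
  have hpos : (0 : ℚ) < (q : ℚ) + 2 := by positivity
  have hdem : ∑ B ∈ Rq M H q, ((((q + 1 : ℕ) : ℚ) + 2) / (((q + 1 : ℕ) : ℚ) + 1)) * GenQ.dem M H t B =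
      ((((q + 1 : ℕ) : ℚ) + 2) / (((q + 1 : ℕ) : ℚ) + 1)) * ((Nq M H q : ℚ) - (DFq M H q t : ℚ)) := by
    rw [← Finset.mul_sum, sum_dem_eq']
  have hN : (Nq M H q : ℚ) = ∑ B ∈ Rq M H q, (1 : ℚ) := by
    unfold Nq
    rw [Finset.card_eq_sum_ones]
    push_cast
    rfl
  have hs3 : ∑ S ∈ Rq M H q, (((q : ℚ) + 2) * ((q : ℚ) + 3 - t) / (2 + (mTr M S : ℚ)) - ((q : ℚ) + 3)) =
      ((q : ℚ) + 2) * ∑ B ∈ Rq M H q, (((((q + 1 : ℕ) : ℚ) + 2 - t) * (1 / (2 + (mTr M B : ℚ))))) -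
        ((q : ℚ) + 3) * ∑ B ∈ Rq M H q, (1 : ℚ) := by
    rw [Finset.mul_sum, Finset.mul_sum, ← Finset.sum_sub_distrib]
    apply Finset.sum_congr rfl
    intro S _
    push_cast
    ring
  rw [Finset.sum_sub_distrib, hdem, hN, hs3, mul_sub]
  have hq1 : ((((q + 1 : ℕ) : ℚ) + 2) / (((q + 1 : ℕ) : ℚ) + 1)) = ((q : ℚ) + 3) / ((q : ℚ) + 2) := by
    push_cast
    ring
  rw [hq1]
  field_simp
  ring

/-- At corank `≤ t − 1` every rank-`q` subset of `H` is demand-free at type `t`, so the trace sum is `≥ 0`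
(`t ≤ q + 3`). -/
theorem traceSum_nonneg_of_card_le' {H : Finset α} {q t : ℕ} (ht1 : 1 ≤ t) (htq : t ≤ q + 3)
    (hcard : H.card ≤ q + (t - 1)) :
    0 ≤ ∑ B ∈ Rq M H q, ((((q + 1 : ℕ) : ℚ) + 2 - t) * (1 / (2 + (mTr M B : ℚ))) -
        ((((q + 1 : ℕ) : ℚ) + 2) / (((q + 1 : ℕ) : ℚ) + 1)) * GenQ.dem M H t B) := by
  apply Finset.sum_nonneg
  intro B hB
  have hB' := mem_Rq.1 hB
  have hdem : GenQ.dem M H t B = 0 := by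
    unfold GenQ.dem
    rw [if_pos]
    have h1 : q ≤ B.card := le_card_of_eRk_eq hB'.2
    have h2 : (H \ B).card = H.card - B.card := Finset.card_sdiff_of_subset hB'.1
    have h3 : (H \ B).card ≤ t - 1 := by omega
    have h4 : M.eRk ((H \ B : Finset α) : Set α) ≤ ((H \ B).card : ℕ∞) := by
      have := M.eRk_le_encard ((H \ B : Finset α) : Set α)
      rwa [Set.encard_coe_eq_coe_finsetCard] at this
    have h5 : ((H \ B).card : ℕ∞) ≤ ((t - 1 : ℕ) : ℕ∞) := by exact_mod_cast h3
    calc M.eRk ((H \ B : Finset α) : Set α) + 1 ≤ ((t - 1 : ℕ) : ℕ∞) + 1 := by gcongr; exact h4.trans h5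
      _ = (t : ℕ∞) := by
        rw [show ((t - 1 : ℕ) : ℕ∞) + 1 = ((t - 1 + 1 : ℕ) : ℕ∞) by push_cast; rfl]
        congr 1
        omega
  rw [hdem, mul_zero, sub_zero]
  have htq' : (t : ℚ) ≤ (q : ℚ) + 3 := by exact_mod_cast htq
  have hm : (0 : ℚ) ≤ mTr M B := by positivity
  have hpos : (0 : ℚ) ≤ 1 / (2 + (mTr M B : ℚ)) := by positivity
  push_cast
  apply mul_nonneg _ hpos
  linarith

end PercRepro.Night4
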